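import Literature.NumberTheory.LFunctions.RHGeneralizedRHSelbergProofs
import Literature.NumberTheory.LFunctions.DedekindZetaERHProofs
import Literature.NumberTheory.LFunctions.DedekindZetaClassicalRegionBounds
import Literature.NumberTheory.LFunctions.DedekindZetaUniformBounds
import Literature.Analysis.Complex.RademacherPhragmenLindelof
import Literature.Analysis.Complex.MellinBarnesShift
import HarnessLib

/-!
# The entire function `(s − 1) ζ_K(s)` and its uniform convexity bound

Topic `Literature/NumberTheory/LFunctions` (namespace `Literature.NumberTheory.LFunctions`, next to
`DedekindZeta.lean`). Everything in this file is PROVED; there are no named facts.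

For a number field `K` of degree `n_K = [K : ℚ]`, discriminant `d_K`, `r₁` real and `r₂` complex
places, let `ζ_K = dedekindZetaCont K` be the continued Dedekind zeta function (Hecke; the tree's
`DedekindZeta*.lean`). We set up the entire function

  `ζ₁_K(s) = (s − 1) ζ_K(s)`  (`dedekindZeta₁ K`, value `res_{s=1} ζ_K` at `s = 1`),

(the named form of the term `Function.update (fun s ↦ (s − 1) * dedekindZetaCont K s) 1 ρ_K`
already used, under the local notation `ζ₁[K]`, in `DedekindZetaNonvanishing.lean`,
`DedekindZetaClassicalRegionBounds.lean` and `RieszMeanInvDedekindZeta.lean`; the definition below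
IS that term, so their lemmas `NumberField.dedekindZeta₁_one`, `NumberField.dedekindZeta₁_eq`,
`NumberField.differentiable_dedekindZeta₁`, `NumberField.classicalZFRData_dedekindZeta₁`, … apply to
it definitionally, and those local notations should be retargeted to `dedekindZeta₁` by a librarian
pass), and prove the **convexity bound, uniform in `K`** (Rademacher, *On the Phragmén–Lindelöf theorem
and some applications*, Math. Z. 72 (1959), Thm. 4 for `ζ_K`; Lagarias–Odlyzko 1977, Lemma 5.? /
§5 in the non-explicit form used there):

* `norm_dedekindZetaCont_eq_of_re_eq_neg_half` — on `Re s = −1/2` the functional equation has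
  EXACT modulus: `|ζ_K(s)| = |d_K| (|s|/2π)^{r₁} (|s||s+1|/4π²)^{r₂} |ζ_K(1 − s)|`
  (`1 − s = s̄ + 2` there, `Γ_ℝ(w+2) = Γ_ℝ(w) w/2π`, `Γ_ℂ(w+1) = Γ_ℂ(w) w/2π`, `|Γ(w̄)| = |Γ(w)|`);
* `norm_dedekindZeta₁_le` — for `Re z ≥ −1/2`,
  `|ζ₁_K(z)| ≤ |d_K| · e^{2 n_K} · |z + 5/2|^{n_K + 1}`,
  from Rademacher's Phragmén–Lindelöf theorem (`rademacher_phragmenLindelof_of_finiteOrder`,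
  `RademacherPhragmenLindelof.lean`) on the strip `[−1/2, 3/2]` with the a-priori finite order
  `dedekindZetaCont_finiteOrder_holds` and the edge bounds `|ζ_K(3/2 + it)| ≤ e^{2n_K}`
  (`DedekindZetaUniformBounds.lean`);
* `norm_dedekindZeta₁_le_of_mem_closedBall` — on the discs `|z − (2 + it)| ≤ 2`:
  `|ζ₁_K(z)| ≤ |d_K| e^{2 n_K} (|t| + 7)^{n_K + 1}`, i.e.
  `log|ζ₁_K| ≤ log|d_K| + 2n_K + (n_K + 1) log(|t| + 7)` — the input of Jensen's formula in
  `DedekindZetaLogDerivGRH.lean`;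
* `exp_neg_finrank_le_norm_dedekindZeta₁_two_add` — `|ζ₁_K(2 + it)| ≥ e^{−n_K}`.

## References

* H. Rademacher, *On the Phragmén–Lindelöf theorem and some applications*, Math. Z. 72 (1959),
  192–204, Theorems 2 and 4 (`Rademacher1959`).
* J. C. Lagarias, A. M. Odlyzko, *Effective versions of the Chebotarev density theorem* (1977),
  §5 (`LagariasOdlyzko1977`).
* J. Neukirch, *Algebraic Number Theory*, Ch. VII (5.10) (functional equation) (`NeukirchANT1999`).
-/

noncomputable section

open Complex Filter Topology Set Metric NumberField NumberField.InfinitePlace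
open scoped NumberField

namespace Literature.NumberTheory.LFunctions

variable (K : Type*) [Field K] [NumberField K]

/-! ### The entire function `ζ₁_K(s) = (s − 1) ζ_K(s)` -/

/-- `ζ₁_K(s) = (s − 1) ζ_K(s)`, completed at `s = 1` by the residue
`ρ_K = res_{s=1} ζ_K = 2^{r₁}(2π)^{r₂} h_K R_K/(w_K √|d_K|)` (Mathlib's `dedekindZeta_residue`), so that
it is entire (Hecke; Neukirch VII (5.10)–(5.11)). This is, verbatim, the term
`Function.update (fun s ↦ (s − 1) * dedekindZetaCont K s) 1 ρ_K` of
`DedekindZetaNonvanishing.lean` (`isLandauContinuation_dedekindZetaCont_holds'`) and of the local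
notations `ζ₁[K]` of `DedekindZetaClassicalRegionBounds.lean`, `RieszMeanInvDedekindZeta.lean`, now
given a name. [cite: NeukirchANT1999, Ch. VII (5.11)] -/
def dedekindZeta₁ : ℂ → ℂ :=
  Function.update (fun s : ℂ ↦ (s - 1) * dedekindZetaCont K s) 1
    ((_root_.NumberField.dedekindZeta_residue K : ℝ) : ℂ)

/-- `dedekindZeta₁ K` is the `Function.update` term of the tree (definitional unfolding). [folklore] -/
theorem dedekindZeta₁_def : dedekindZeta₁ K =
    Function.update (fun s : ℂ ↦ (s - 1) * dedekindZetaCont K s) 1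
      ((_root_.NumberField.dedekindZeta_residue K : ℝ) : ℂ) := rfl

/-- `ζ₁_K(1) = res_{s=1} ζ_K` (`NumberField.dedekindZeta₁_one`). [folklore] -/
@[simp] theorem dedekindZeta₁_apply_one : dedekindZeta₁ K 1 = _root_.NumberField.dedekindZeta_residue K :=
  NumberField.dedekindZeta₁_one K

variable {K} in
/-- `ζ₁_K(s) = (s − 1) ζ_K(s)` for `s ≠ 1` (`NumberField.dedekindZeta₁_eq`). [folklore] -/
theorem dedekindZeta₁_apply_of_ne_one {s : ℂ} (hs : s ≠ 1) :
    dedekindZeta₁ K s = (s - 1) * dedekindZetaCont K s :=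
  NumberField.dedekindZeta₁_eq hs

variable {K} in
/-- For `Re s > 1`, `ζ₁_K(s) = (s − 1) ∑ a_n n^{-s}` (the Dirichlet series
`NumberField.dedekindZeta K`; cf. `NumberField.dedekindZeta₁_eq_mul_dedekindZeta` of
`RieszMeanInvDedekindZeta.lean`, not imported here). [folklore] -/
theorem dedekindZeta₁_apply_eq_mul {s : ℂ} (hs : 1 < s.re) :
    dedekindZeta₁ K s = (s - 1) * _root_.NumberField.dedekindZeta K s := by
  have hs1 : s ≠ 1 := fun h => by rw [h, one_re] at hs; exact lt_irrefl _ hs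
  rw [dedekindZeta₁_apply_of_ne_one hs1, dedekindZetaCont_eq_dedekindZeta_holds hs]

/-- **`ζ₁_K` is entire** (Hecke 1917; Neukirch VII (5.11)) — the tree's
`NumberField.differentiable_dedekindZeta₁`, restated for the named function.
[cite: NeukirchANT1999, Ch. VII (5.11)] -/
theorem dedekindZeta₁_differentiable : Differentiable ℂ (dedekindZeta₁ K) :=
  NumberField.differentiable_dedekindZeta₁ K

/-- `ζ₁_K` is analytic on every set. [folklore] -/
theorem analyticOnNhd_dedekindZeta₁ (S : Set ℂ) : AnalyticOnNhd ℂ (dedekindZeta₁ K) S :=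
  (dedekindZeta₁_differentiable K).differentiableOn.analyticOnNhd isOpen_univ |>.mono (subset_univ S)

variable {K} in
/-- **`ζ₁_K(s) ≠ 0` for `Re s ≥ 1`**: off `1` this is the non-vanishing of `ζ_K` on the closed
half-plane (`dedekindZetaCont_ne_zero_of_one_le_re_holds`, Landau 1903), at `1` the residue is
positive. [folklore] -/
theorem dedekindZeta₁_ne_zero_of_one_le_re {s : ℂ} (hs : 1 ≤ s.re) : dedekindZeta₁ K s ≠ 0 := by
  rcases eq_or_ne s 1 with rfl | hs1
  · rw [dedekindZeta₁_apply_one]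
    exact_mod_cast _root_.NumberField.dedekindZeta_residue_ne_zero K
  · rw [dedekindZeta₁_apply_of_ne_one hs1]
    exact mul_ne_zero (sub_ne_zero.mpr hs1) (dedekindZetaCont_ne_zero_of_one_le_re_holds K hs hs1)

variable {K} in
/-- A zero of `ζ₁_K` is a zero of `ζ_K` off `s = 1`. [folklore] -/
theorem dedekindZetaCont_eq_zero_of_dedekindZeta₁_eq_zero {s : ℂ} (h : dedekindZeta₁ K s = 0) :
    s ≠ 1 ∧ dedekindZetaCont K s = 0 := by
  have hs1 : s ≠ 1 := by
    rintro rfl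
    exact dedekindZeta₁_ne_zero_of_one_le_re (by simp) h
  rw [dedekindZeta₁_apply_of_ne_one hs1] at h
  exact ⟨hs1, (mul_eq_zero.mp h).resolve_left (sub_ne_zero.mpr hs1)⟩

/-- **`|ζ₁_K(2 + it)| ≥ e^{−n_K}`**: `|1 + it| ≥ 1` and `|ζ_K(2 + it)| ≥ e^{−n_K/(2−1)}`
(`exp_neg_finrank_div_le_norm_dedekindZeta`). [folklore] -/
theorem exp_neg_finrank_le_norm_dedekindZeta₁_two_add (t : ℝ) :
    Real.exp (-(Module.finrank ℚ K : ℝ)) ≤ ‖dedekindZeta₁ K (2 + t * I)‖ := by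
  have hre : (2 + t * I : ℂ).re = 2 := by simp
  have h2 : 1 < (2 + t * I : ℂ).re := by rw [hre]; norm_num
  rw [dedekindZeta₁_apply_eq_mul h2, norm_mul]
  have h1 : 1 ≤ ‖(2 + t * I : ℂ) - 1‖ := by
    have : ((2 + t * I : ℂ) - 1).re = 1 := by simp; norm_num
    calc (1 : ℝ) = |((2 + t * I : ℂ) - 1).re| := by rw [this, abs_one]
      _ ≤ ‖(2 + t * I : ℂ) - 1‖ := abs_re_le_norm _
  have hζ := NumberField.exp_neg_finrank_div_le_norm_dedekindZeta K h2
  rw [hre, show (2 : ℝ) - 1 = 1 by norm_num, div_one] at hζ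
  calc Real.exp (-(Module.finrank ℚ K : ℝ)) = 1 * Real.exp (-(Module.finrank ℚ K : ℝ)) :=
        (one_mul _).symm
    _ ≤ ‖(2 + t * I : ℂ) - 1‖ * ‖NumberField.dedekindZeta K (2 + ↑t * I)‖ :=
        mul_le_mul h1 hζ (Real.exp_pos _).le (norm_nonneg _)

/-! ### The functional equation on `Re s = −1/2`: exact modulus -/

/-- `|Γ_ℝ(s̄)| = |Γ_ℝ(s)|`. [folklore] -/
theorem norm_Gammaℝ_conj (s : ℂ) : ‖Gammaℝ (starRingEnd ℂ s)‖ = ‖Gammaℝ s‖ := by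
  rw [Gammaℝ_def, Gammaℝ_def, norm_mul, norm_mul, norm_cpow_eq_rpow_re_of_pos Real.pi_pos,
    norm_cpow_eq_rpow_re_of_pos Real.pi_pos]
  congr 1
  · congr 1
    simp
  · rw [show starRingEnd ℂ s / 2 = starRingEnd ℂ (s / 2) by rw [map_div₀, map_ofNat], Complex.Gamma_conj,
      Complex.norm_conj]

/-- `|Γ_ℂ(s̄)| = |Γ_ℂ(s)|`. [folklore] -/
theorem norm_Gammaℂ_conj (s : ℂ) : ‖Gammaℂ (starRingEnd ℂ s)‖ = ‖Gammaℂ s‖ := by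
  rw [Gammaℂ_def, Gammaℂ_def, norm_mul, norm_mul, norm_mul, norm_mul, Complex.Gamma_conj,
    Complex.norm_conj]
  congr 2
  rw [show (2 * (Real.pi : ℂ)) = ((2 * Real.pi : ℝ) : ℂ) by push_cast; ring,
    norm_cpow_eq_rpow_re_of_pos (by positivity), norm_cpow_eq_rpow_re_of_pos (by positivity)]
  simp

variable {K} in
/-- `|Γ_ℝ(s̄ + 2)| = |Γ_ℝ(s)| · |s|/(2π)` (`Γ_ℝ(w + 2) = Γ_ℝ(w) w/(2π)`). [folklore] -/
theorem norm_Gammaℝ_conj_add_two {s : ℂ} (hs : s ≠ 0) :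
    ‖Gammaℝ (starRingEnd ℂ s + 2)‖ = ‖Gammaℝ s‖ * ‖s‖ / (2 * Real.pi) := by
  have hcs : starRingEnd ℂ s ≠ 0 := (map_ne_zero _).mpr hs
  rw [Gammaℝ_add_two hcs]
  simp only [norm_div, norm_mul, norm_Gammaℝ_conj, Complex.norm_conj, Complex.norm_two,
    Complex.norm_real, Real.norm_of_nonneg Real.pi_pos.le]
  ring

variable {K} in
/-- `|Γ_ℂ(s̄ + 2)| = |Γ_ℂ(s)| · |s| |s + 1|/(2π)²` (`Γ_ℂ(w + 1) = Γ_ℂ(w) w/(2π)` twice). [folklore] -/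
theorem norm_Gammaℂ_conj_add_two {s : ℂ} (hs : s ≠ 0) (hs1 : s + 1 ≠ 0) :
    ‖Gammaℂ (starRingEnd ℂ s + 2)‖ = ‖Gammaℂ s‖ * ‖s‖ * ‖s + 1‖ / (2 * Real.pi) ^ 2 := by
  have hcs : starRingEnd ℂ s ≠ 0 := (map_ne_zero _).mpr hs
  have hconj1 : starRingEnd ℂ s + 1 = starRingEnd ℂ (s + 1) := by simp
  have hcs1 : starRingEnd ℂ s + 1 ≠ 0 := by rw [hconj1]; exact (map_ne_zero _).mpr hs1
  rw [show starRingEnd ℂ s + 2 = (starRingEnd ℂ s + 1) + 1 by ring, Gammaℂ_add_one hcs1,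
    Gammaℂ_add_one hcs]
  simp only [norm_div, norm_mul, norm_Gammaℂ_conj, Complex.norm_conj, Complex.norm_two,
    Complex.norm_real, Real.norm_of_nonneg Real.pi_pos.le, hconj1]
  ring

variable {K} in
/-- A point with `Re s = −1/2` is not an integer, is `≠ 0` and has `s + 1 ≠ 0`. [folklore] -/
theorem ne_int_of_re_eq_neg_half {s : ℂ} (hs : s.re = -1 / 2) :
    (∀ n : ℤ, s ≠ n) ∧ s ≠ 0 ∧ s + 1 ≠ 0 := by
  refine ⟨fun n h => ?_, fun h => ?_, fun h => ?_⟩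
  · have h1 := congrArg re h
    rw [hs, intCast_re] at h1
    have h2 : (2 * n : ℝ) = -1 := by linarith
    have h3 : (2 * n : ℤ) = -1 := by exact_mod_cast h2
    omega
  · rw [h, zero_re] at hs; norm_num at hs
  · have h1 := congrArg re h
    rw [add_re, one_re, hs, zero_re] at h1
    norm_num at h1

/-- **The functional equation on the line `Re s = −1/2`, in modulus** (Hecke; Neukirch VII
(5.10) `Λ_K(1 − s) = Λ_K(s)`, `Λ_K(s) = |d_K|^{s/2} Γ_ℝ(s)^{r₁} Γ_ℂ(s)^{r₂} ζ_K(s)`): for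
`Re s = −1/2`,
`|ζ_K(s)| = |d_K| · (|s|/2π)^{r₁} · (|s| |s+1|/(2π)²)^{r₂} · |ζ_K(1 − s)|`.
On this line `1 − s = s̄ + 2`, and the gamma quotients have exact modulus by the recursions
`Γ_ℝ(w + 2) = Γ_ℝ(w) w/2π`, `Γ_ℂ(w + 1) = Γ_ℂ(w) w/2π` and `|Γ(w̄)| = |Γ(w)|` — no Stirling
formula is needed (the device of Rademacher 1959, §5). [cite: Rademacher1959, Thm. 4] -/
theorem norm_dedekindZetaCont_eq_of_re_eq_neg_half {s : ℂ} (hs : s.re = -1 / 2) :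
    ‖dedekindZetaCont K s‖ =
      ((discr K).natAbs : ℝ) * (‖s‖ / (2 * Real.pi)) ^ nrRealPlaces K *
        (‖s‖ * ‖s + 1‖ / (2 * Real.pi) ^ 2) ^ nrComplexPlaces K * ‖dedekindZetaCont K (1 - s)‖ := by
  obtain ⟨hsZ, hs0, hs1⟩ := ne_int_of_re_eq_neg_half hs
  have h1s : 1 - s = starRingEnd ℂ s + 2 :=
    Complex.ext (by simp [hs]; norm_num) (by simp)
  have hFE := completedDedekindZeta_one_sub_holds (K := K) hsZ
  unfold completedDedekindZeta dedekindGammaFactor at hFE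
  have hn := congrArg norm hFE
  simp only [norm_mul, norm_pow] at hn
  have hdpos : 0 < (discr K).natAbs := Int.natAbs_pos.mpr (discr_ne_zero K)
  have hd : (0 : ℝ) < ((discr K).natAbs : ℝ) := by exact_mod_cast hdpos
  rw [norm_natCast_cpow_of_pos hdpos, norm_natCast_cpow_of_pos hdpos] at hn
  have hre1 : ((1 - s) / 2).re = 1 + (-1 / 4 : ℝ) := by simp [hs]; norm_num
  have hre2 : (s / 2).re = (-1 / 4 : ℝ) := by simp [hs]; norm_num
  have hΓℝ : ‖Gammaℝ (1 - s)‖ = ‖Gammaℝ s‖ * ‖s‖ / (2 * Real.pi) := by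
    rw [h1s]; exact norm_Gammaℝ_conj_add_two hs0
  have hΓℂ : ‖Gammaℂ (1 - s)‖ = ‖Gammaℂ s‖ * ‖s‖ * ‖s + 1‖ / (2 * Real.pi) ^ 2 := by
    rw [h1s]; exact norm_Gammaℂ_conj_add_two hs0 hs1
  rw [hre1, hre2, Real.rpow_add hd, Real.rpow_one, hΓℝ, hΓℂ] at hn
  -- positivity of the common factors
  have hg1 : 0 < ‖Gammaℝ s‖ := by
    refine norm_pos_iff.mpr ?_
    rw [Ne, Gammaℝ_eq_zero_iff]
    rintro ⟨n, hn'⟩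
    exact hsZ (-(2 * n)) (by rw [hn']; push_cast; ring)
  have hg2 : 0 < ‖Gammaℂ s‖ := by
    refine norm_pos_iff.mpr ?_
    rw [Gammaℂ_def]
    refine mul_ne_zero (mul_ne_zero two_ne_zero ?_) (Complex.Gamma_ne_zero fun m hm ↦ hsZ (-m) ?_)
    · rw [Ne, cpow_eq_zero_iff, not_and_or]
      exact Or.inl (mul_ne_zero two_ne_zero (ofReal_ne_zero.mpr Real.pi_ne_zero))
    · rw [hm]; push_cast; ring
  have he : 0 < ((discr K).natAbs : ℝ) ^ (-1 / 4 : ℝ) := Real.rpow_pos_of_pos hd _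
  have hP : ((discr K).natAbs : ℝ) ^ (-1 / 4 : ℝ) * ‖Gammaℝ s‖ ^ nrRealPlaces K *
      ‖Gammaℂ s‖ ^ nrComplexPlaces K ≠ 0 :=
    (mul_pos (mul_pos he (pow_pos hg1 _)) (pow_pos hg2 _)).ne'
  have key : ((discr K).natAbs : ℝ) ^ (-1 / 4 : ℝ) * ‖Gammaℝ s‖ ^ nrRealPlaces K *
      ‖Gammaℂ s‖ ^ nrComplexPlaces K * ‖dedekindZetaCont K s‖ =
      ((discr K).natAbs : ℝ) ^ (-1 / 4 : ℝ) * ‖Gammaℝ s‖ ^ nrRealPlaces K *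
        ‖Gammaℂ s‖ ^ nrComplexPlaces K *
        (((discr K).natAbs : ℝ) * (‖s‖ / (2 * Real.pi)) ^ nrRealPlaces K *
          (‖s‖ * ‖s + 1‖ / (2 * Real.pi) ^ 2) ^ nrComplexPlaces K *
            ‖dedekindZetaCont K (1 - s)‖) := by
    rw [← hn]; ring
  exact mul_left_cancel₀ hP key

/-! ### Edge bounds and the a-priori order -/

variable {K} in
/-- For `Re z ≥ 3/2`: `|ζ₁_K(z)| ≤ |z − 1| e^{2 n_K}` (`|ζ_K(z)| ≤ e^{n_K/(σ−1)} ≤ e^{2n_K}`,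
`DedekindZetaUniformBounds.lean`). [folklore] -/
theorem norm_dedekindZeta₁_le_of_three_halves_le_re {z : ℂ} (hz : 3 / 2 ≤ z.re) :
    ‖dedekindZeta₁ K z‖ ≤ ‖z - 1‖ * Real.exp (2 * Module.finrank ℚ K) := by
  have hz1 : 1 < z.re := by linarith
  rw [dedekindZeta₁_apply_eq_mul hz1, norm_mul]
  refine mul_le_mul_of_nonneg_left ?_ (norm_nonneg _)
  refine (NumberField.norm_dedekindZeta_le_exp_finrank_div K hz1).trans (Real.exp_le_exp.2 ?_)
  have hn : (0 : ℝ) ≤ Module.finrank ℚ K := Nat.cast_nonneg _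
  rw [div_le_iff₀ (by linarith)]
  nlinarith

/-- **`ζ₁_K` has finite order, with a positive exponent**: `|ζ₁_K(s)| ≤ A e^{‖s‖^B}` for all `s`,
some `A, B > 0` — from the tree's `dedekindZetaCont_finiteOrder_holds` (`B` arbitrary there),
raising the exponent to `max B 1` for `‖s‖ ≥ 1` and using continuity on the unit disc.
[folklore] -/
theorem exists_norm_dedekindZeta₁_le_exp_rpow :
    ∃ A B : ℝ, 0 < A ∧ 0 < B ∧ ∀ s : ℂ, ‖dedekindZeta₁ K s‖ ≤ A * Real.exp (‖s‖ ^ B) := by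
  obtain ⟨A₀, B₀, hA₀, hfo⟩ := (dedekindZetaCont_finiteOrder_holds K).exists_pos
  -- a bound on the closed unit disc
  obtain ⟨M, hM⟩ := (isCompact_closedBall (0 : ℂ) 1).exists_bound_of_continuousOn
    (dedekindZeta₁_differentiable K).continuous.continuousOn
  have hM0 : 0 ≤ M := (norm_nonneg _).trans (hM 0 (mem_closedBall_self zero_le_one))
  refine ⟨A₀ + M + 1, max B₀ 1, by positivity, by positivity, fun s ↦ ?_⟩
  have hE1 : 1 ≤ Real.exp (‖s‖ ^ max B₀ 1) := Real.one_le_exp (Real.rpow_nonneg (norm_nonneg _) _)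
  rcases le_or_gt ‖s‖ 1 with hs | hs
  · have h1 : ‖dedekindZeta₁ K s‖ ≤ M := hM s (by simpa using hs)
    calc ‖dedekindZeta₁ K s‖ ≤ M := h1
      _ ≤ (A₀ + M + 1) * 1 := by linarith
      _ ≤ (A₀ + M + 1) * Real.exp (‖s‖ ^ max B₀ 1) := by gcongr
  · have hs1 : s ≠ 1 := by
      rintro rfl
      simp at hs
    rw [dedekindZeta₁_apply_of_ne_one hs1]
    have hB : ‖s‖ ^ B₀ ≤ ‖s‖ ^ max B₀ 1 :=
      Real.rpow_le_rpow_of_exponent_le hs.le (le_max_left _ _)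
    calc ‖(s - 1) * dedekindZetaCont K s‖ ≤ A₀ * Real.exp (‖s‖ ^ B₀) := hfo s hs1
      _ ≤ A₀ * Real.exp (‖s‖ ^ max B₀ 1) := by gcongr
      _ ≤ (A₀ + M + 1) * Real.exp (‖s‖ ^ max B₀ 1) := by gcongr; linarith

/-! ### The convexity bound -/

variable {K} in
/-- Norm comparison by real and imaginary parts. [folklore] -/
theorem norm_le_norm_of_sq_le {w w' : ℂ} (h : w.re ^ 2 + w.im ^ 2 ≤ w'.re ^ 2 + w'.im ^ 2) :
    ‖w‖ ≤ ‖w'‖ := by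
  rw [Complex.norm_def, Complex.norm_def, normSq_apply, normSq_apply]
  exact Real.sqrt_le_sqrt (by nlinarith)

/-- **Uniform convexity bound for `ζ₁_K`** (Rademacher 1959, Thm. 4, for `ζ_K`, in a simplified
form with absolute numerical constants): for `Re z ≥ −1/2`,
`|ζ₁_K(z)| ≤ |d_K| · e^{2 n_K} · |z + 5/2|^{n_K + 1}`.
Proof: Rademacher's Phragmén–Lindelöf theorem on the strip `−1/2 ≤ σ ≤ 3/2` with `Q = 5/2`;
on `σ = 3/2`, `|ζ₁_K| ≤ |z−1| e^{2n_K} ≤ e^{2n_K}|Q+z|`; on `σ = −1/2`, by the exact functional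
equation, `|ζ₁_K| ≤ |d_K| e^{2n_K} |Q+z|^{1+r₁+2r₂} = |d_K| e^{2n_K}|Q+z|^{1+n_K}`; the a-priori
finite order is `exists_norm_dedekindZeta₁_le_exp_rpow`; for `σ ≥ 3/2` the right-edge
estimate applies directly. [cite: Rademacher1959, Thm. 4] -/
theorem norm_dedekindZeta₁_le {z : ℂ} (hz₁ : -1 / 2 ≤ z.re) :
    ‖dedekindZeta₁ K z‖ ≤ ((discr K).natAbs : ℝ) * Real.exp (2 * Module.finrank ℚ K) *
      ‖z + 5 / 2‖ ^ (Module.finrank ℚ K + 1) := by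
  set n : ℕ := Module.finrank ℚ K with hn
  set d : ℝ := ((discr K).natAbs : ℝ) with hd
  set E : ℝ := Real.exp (2 * n) with hE
  have hd1 : 1 ≤ d := by
    rw [hd]; exact_mod_cast Int.natAbs_pos.mpr (discr_ne_zero K)
  have hd0 : 0 < d := by linarith
  have hE0 : 0 < E := Real.exp_pos _
  have hE1 : 1 ≤ E := Real.one_le_exp (by positivity)
  -- the norm `N = |Q + z|`, `Q = 5/2`
  have hQz : ((5 / 2 : ℝ) : ℂ) + z = z + 5 / 2 := by push_cast; ring
  have hN2 : ∀ w : ℂ, -1 / 2 ≤ w.re → 2 ≤ ‖w + 5 / 2‖ := fun w hw ↦ by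
    calc (2 : ℝ) ≤ |(w + 5 / 2).re| := by
          rw [abs_of_nonneg (by simp; linarith)]; simp; linarith
      _ ≤ ‖w + 5 / 2‖ := abs_re_le_norm _
  have hzm1 : ∀ w : ℂ, -1 / 2 ≤ w.re → ‖w - 1‖ ≤ ‖w + 5 / 2‖ := fun w hw ↦
    norm_le_norm_of_sq_le (by simp; nlinarith)
  -- the case `3/2 ≤ Re z ≤ 4`: the right-edge estimate directly
  rcases le_or_gt (3 / 2 : ℝ) z.re with hz3 | hz3
  · have hN1 : 1 ≤ ‖z + 5 / 2‖ := le_trans (by norm_num) (hN2 z hz₁)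
    calc ‖dedekindZeta₁ K z‖ ≤ ‖z - 1‖ * E := norm_dedekindZeta₁_le_of_three_halves_le_re hz3
      _ ≤ ‖z + 5 / 2‖ * E := by gcongr; exact hzm1 z hz₁
      _ = 1 * E * ‖z + 5 / 2‖ ^ 1 := by ring
      _ ≤ d * E * ‖z + 5 / 2‖ ^ (n + 1) := by
          gcongr
          all_goals omega
  -- the strip `−1/2 ≤ Re z ≤ 3/2`: Rademacher
  obtain ⟨A₁, B₁, hA₁, hB₁, hgr₁⟩ := exists_norm_dedekindZeta₁_le_exp_rpow K
  obtain ⟨K₁, hK₁, hgr₂⟩ := Literature.Analysis.Complex.exists_exp_norm_rpow_le 4 B₁ (by norm_num) hB₁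
  have hgr : ∀ w : ℂ, (-1 / 2 : ℝ) < w.re → w.re < 3 / 2 →
      ‖dedekindZeta₁ K w‖ ≤ A₁ * K₁ * Real.exp (|w.im| ^ (B₁ + 1)) := by
    intro w hw1 hw2
    have hre : |w.re| ≤ 4 := abs_le.mpr ⟨by linarith, by linarith⟩
    calc ‖dedekindZeta₁ K w‖ ≤ A₁ * Real.exp (‖w‖ ^ B₁) := hgr₁ w
      _ ≤ A₁ * (K₁ * Real.exp (|w.im| ^ (B₁ + 1))) := by gcongr; exact hgr₂ w hre
      _ = A₁ * K₁ * Real.exp (|w.im| ^ (B₁ + 1)) := by ring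
  -- right edge
  have hb : ∀ w : ℂ, w.re = 3 / 2 →
      ‖dedekindZeta₁ K w‖ ≤ E * ‖((5 / 2 : ℝ) : ℂ) + w‖ ^ (1 : ℝ) := by
    intro w hw
    rw [Real.rpow_one, show ((5 / 2 : ℝ) : ℂ) + w = w + 5 / 2 by push_cast; ring]
    calc ‖dedekindZeta₁ K w‖ ≤ ‖w - 1‖ * E := norm_dedekindZeta₁_le_of_three_halves_le_re hw.ge
      _ ≤ ‖w + 5 / 2‖ * E := by gcongr; exact hzm1 w (by rw [hw]; norm_num)
      _ = E * ‖w + 5 / 2‖ := mul_comm _ _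
  -- left edge
  have ha : ∀ w : ℂ, w.re = -1 / 2 →
      ‖dedekindZeta₁ K w‖ ≤ d * E * ‖((5 / 2 : ℝ) : ℂ) + w‖ ^ ((n + 1 : ℕ) : ℝ) := by
    intro w hw
    obtain ⟨hwZ, hw0, hw1'⟩ := ne_int_of_re_eq_neg_half hw
    have hw1 : w ≠ 1 := fun h ↦ hwZ 1 (by simpa using h)
    rw [Real.rpow_natCast, show ((5 / 2 : ℝ) : ℂ) + w = w + 5 / 2 by push_cast; ring,
      dedekindZeta₁_apply_of_ne_one hw1, norm_mul, norm_dedekindZetaCont_eq_of_re_eq_neg_half K hw]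
    set N : ℝ := ‖w + 5 / 2‖ with hN
    have hN2' : 2 ≤ N := hN2 w (by rw [hw])
    have hwN : ‖w‖ ≤ N := norm_le_norm_of_sq_le (by simp; nlinarith)
    have hw1N : ‖w + 1‖ ≤ N := norm_le_norm_of_sq_le (by simp; nlinarith)
    have hwm1N : ‖w - 1‖ ≤ N := hzm1 w (by rw [hw])
    have hpi : 1 ≤ 2 * Real.pi := by linarith [Real.pi_gt_three]
    have hX : ‖w‖ / (2 * Real.pi) ≤ N := by
      rw [div_le_iff₀ (by positivity)]
      calc ‖w‖ ≤ N := hwN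
        _ = N * 1 := (mul_one N).symm
        _ ≤ N * (2 * Real.pi) := by gcongr
    have hY : ‖w‖ * ‖w + 1‖ / (2 * Real.pi) ^ 2 ≤ N ^ 2 := by
      rw [div_le_iff₀ (by positivity)]
      calc ‖w‖ * ‖w + 1‖ ≤ N * N := mul_le_mul hwN hw1N (norm_nonneg _) (by linarith)
        _ = N ^ 2 * 1 := by ring
        _ ≤ N ^ 2 * (2 * Real.pi) ^ 2 := by gcongr; nlinarith
    have h1w : 1 < (1 - w).re := by simp [hw]; norm_num
    have hζ : ‖dedekindZetaCont K (1 - w)‖ ≤ E := by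
      rw [dedekindZetaCont_eq_dedekindZeta_holds h1w]
      refine (NumberField.norm_dedekindZeta_le_exp_finrank_div K h1w).trans (le_of_eq ?_)
      rw [hE]; congr 1
      simp [hw]; ring
    have hrank : nrRealPlaces K + 2 * nrComplexPlaces K = n := card_add_two_mul_card_eq_rank K
    calc ‖w - 1‖ * (d * (‖w‖ / (2 * Real.pi)) ^ nrRealPlaces K *
          (‖w‖ * ‖w + 1‖ / (2 * Real.pi) ^ 2) ^ nrComplexPlaces K * ‖dedekindZetaCont K (1 - w)‖)
        ≤ N * (d * N ^ nrRealPlaces K * (N ^ 2) ^ nrComplexPlaces K * E) := by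
          gcongr
      _ = d * E * N ^ (nrRealPlaces K + 2 * nrComplexPlaces K + 1) := by ring
      _ = d * E * N ^ (n + 1) := by rw [hrank]
  -- Rademacher's theorem
  have hβα : (1 : ℝ) ≤ ((n + 1 : ℕ) : ℝ) := by exact_mod_cast Nat.le_add_left 1 n
  have hR := Literature.Analysis.Complex.rademacher_phragmenLindelof_of_finiteOrder
    (f := dedekindZeta₁ K) (a := -1 / 2) (b := 3 / 2) (Q := 5 / 2) (A := d * E) (B := E)
    (α := ((n + 1 : ℕ) : ℝ)) (β := 1) (C := A₁ * K₁) (c := B₁ + 1)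
    (by norm_num) (by norm_num) (by positivity) hE0 hβα
    (dedekindZeta₁_differentiable K).diffContOnCl (by positivity) hgr ha hb hz₁ hz3.le
  rw [hQz, Real.rpow_one] at hR
  -- simplify the interpolated bound: `X^p Y^q ≤ X` for `Y ≤ X`, `p + q = 1`
  set N : ℝ := ‖z + 5 / 2‖ with hN
  have hN2' : 2 ≤ N := hN2 z hz₁
  have hN1 : 1 ≤ N := by linarith
  set X : ℝ := d * E * N ^ ((n + 1 : ℕ) : ℝ) with hX
  set Y : ℝ := E * N with hY
  have hY0 : 0 < Y := by positivity
  have hYX : Y ≤ X := by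
    rw [hX, hY, Real.rpow_natCast]
    calc E * N = 1 * E * N ^ 1 := by ring
      _ ≤ d * E * N ^ (n + 1) := by
          gcongr
          all_goals omega
  have hX0 : 0 < X := hY0.trans_le hYX
  set p : ℝ := (3 / 2 - z.re) / (3 / 2 - -1 / 2) with hp
  set q : ℝ := (z.re - -1 / 2) / (3 / 2 - -1 / 2) with hq
  have hp0 : 0 ≤ p := by rw [hp]; apply div_nonneg <;> linarith
  have hq0 : 0 ≤ q := by rw [hq]; apply div_nonneg <;> linarith
  have hpq : p + q = 1 := by rw [hp, hq]; field_simp; ring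
  have hfin : X ^ p * Y ^ q ≤ X := by
    calc X ^ p * Y ^ q ≤ X ^ p * X ^ q := by
          gcongr
      _ = X := by rw [← Real.rpow_add hX0, hpq, Real.rpow_one]
  calc ‖dedekindZeta₁ K z‖ ≤ X ^ p * Y ^ q := hR
    _ ≤ X := hfin
    _ = d * E * N ^ (n + 1) := by rw [hX, Real.rpow_natCast]

/-- **The convexity bound on the discs `|z − (2 + it)| ≤ 2`** (the input of Jensen's formula in
`DedekindZetaLogDerivGRH.lean`): `|ζ₁_K(z)| ≤ |d_K| e^{2n_K} (|t| + 7)^{n_K + 1}`.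
[cite: Rademacher1959, Thm. 4] -/
theorem norm_dedekindZeta₁_le_of_mem_closedBall (t : ℝ) {z : ℂ}
    (hz : z ∈ closedBall (2 + t * I) 2) :
    ‖dedekindZeta₁ K z‖ ≤ ((discr K).natAbs : ℝ) * Real.exp (2 * Module.finrank ℚ K) *
      (|t| + 7) ^ (Module.finrank ℚ K + 1) := by
  rw [mem_closedBall, dist_eq_norm] at hz
  have hre : |z.re - 2| ≤ 2 := by
    have := abs_re_le_norm (z - (2 + t * I))
    simp at this
    linarith
  have hz₁ : -1 / 2 ≤ z.re := by have := (abs_le.mp hre).1; linarith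
  refine (norm_dedekindZeta₁_le K hz₁).trans ?_
  have hN : ‖z + 5 / 2‖ ≤ |t| + 7 := by
    calc ‖z + 5 / 2‖ = ‖(z - (2 + t * I)) + (9 / 2 + t * I)‖ := by ring_nf
      _ ≤ ‖z - (2 + t * I)‖ + ‖(9 / 2 : ℂ) + t * I‖ := norm_add_le _ _
      _ ≤ 2 + (9 / 2 + |t|) := by
          gcongr
          calc ‖(9 / 2 : ℂ) + t * I‖ ≤ |((9 / 2 : ℂ) + t * I).re| + |((9 / 2 : ℂ) + t * I).im| :=
                Complex.norm_le_abs_re_add_abs_im _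
            _ = 9 / 2 + |t| := by simp; norm_num
      _ ≤ |t| + 7 := by linarith
  gcongr

end Literature.NumberTheory.LFunctions

end
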